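import Summits.ABC.ABC.Theses.IsogenyGlueCongruence
import HarnessLib

/-!
# Route IsogenyGlueCongruence — support item `DegreePrimesOfGluingBound` (stmt-ABC-13921)

The layer-2 glue of route `IsogenyGlueCongruence`:

> `EllipticGluingPrimeBound → ModularJacobianMultipliers → SemistableHeightPolyBound →
>  DegreePrimesPolyBounded`.

Given a semistable, globally minimal `W` of conductor `N = W.conductorNorm ℤ ≥ 1`, the Jacobian
item supplies a parametrisation datum `D`, abelian varieties `E`, `J` with a Galois-equivariant
`E(ℚ̄) ≃ W(ℚ̄)`, the bound `dim J ≤ N²`, a non-zero `E`-multiplier of `J`, and the divisibility of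
every `E`-multiplier of `J` by `deg D`.  A prime `ℓ ∣ deg D` therefore divides every multiplier, so
the gluing bound `U` gives `ℓ ≤ C · (dim J · max(1, h_F(W)))^κ` with absolute `κ ≥ 0`, `C`.  With
`h_F(W) ≤ c N²` (height item), `dim J ≤ N²` and `N ≥ 1` the base is at most `max(1,c) · N⁴`, and
monotonicity of `x ↦ x^κ` on `[0, ∞)` for `κ ≥ 0` yields
`ℓ ≤ max(C,0) · max(1,c)^κ · N^(4κ)`, i.e. `DegreePrimesPolyBounded` with `κ' = 4κ`,
`C' = max(C,0) · max(1,c)^κ`.  Pure bookkeeping (`Real.rpow_le_rpow`, `Real.mul_rpow`,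
`Real.rpow_natCast_mul`); no literature input.  Closes `--workitem stmt-ABC-13921`.
-/

-- `Summit.<Summit>.<Problem>` is the mandated summit-side namespace (CONVENTIONS §2); for the
-- single-conjunct summit `ABC` the two coincide, so the duplicate `ABC.ABC` is deliberate.
set_option linter.dupNamespace false

namespace Summit.ABC.ABC.Theorems

open Summit.ABC.ABC.Theses.IsogenyGlueCongruence

/-- **`DegreePrimesOfGluingBound` holds** (route `IsogenyGlueCongruence`, item stmt-ABC-13921):
the gluing prime bound `U = EllipticGluingPrimeBound`, its modular instance
`ModularJacobianMultipliers` and the height bound `SemistableHeightPolyBound` together give crux A,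
`DegreePrimesPolyBounded`, with exponent `4κ` and constant `max C 0 * (max 1 c) ^ κ` built from the
constants `κ, C` of `U` and `c` of the height bound.  Proof: for `W` semistable take
`⟨D, E, J, e, he, hdim, hne, hdiv⟩` from the Jacobian item; `ℓ ∣ deg D` and `(deg D : ℤ) ∣ n` give
`(ℓ : ℤ) ∣ n` for every `E`-multiplier `n` of `J`, so `U` applies; then
`dim J · max 1 h_F(W) ≤ N² · (max 1 c · N²) = max 1 c · N⁴` (`N ≥ 1` from `NeZero`), and
`Real.rpow_le_rpow` (base `≥ 0`, `κ ≥ 0`), `Real.mul_rpow`, `Real.rpow_natCast_mul` finish. -/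
theorem degreePrimesOfGluingBound_proof :
    Summit.ABC.ABC.Theses.IsogenyGlueCongruence.DegreePrimesOfGluingBound := by
  unfold Summit.ABC.ABC.Theses.IsogenyGlueCongruence.DegreePrimesOfGluingBound
    Summit.ABC.ABC.Theses.IsogenyGlueCongruence.DegreePrimesPolyBounded
  intro hU hJ hH
  obtain ⟨κ, C, hκ, hU⟩ := hU
  obtain ⟨c, hc⟩ := hH
  refine ⟨4 * κ, max C 0 * (max 1 c) ^ κ, ?_⟩
  intro W _ _ _ hW
  obtain ⟨D, E, J, e, he, hdim, hne, hdiv⟩ := hJ W hW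
  refine ⟨D, fun ℓ hℓ hℓD ↦ ?_⟩
  -- Step 1: the gluing bound applies to the pair (E, J) at the prime ℓ.
  have hU1 : (ℓ : ℝ) ≤ C * ((J.dim : ℝ) * max 1 W.stableFaltingsHeight) ^ κ :=
    hU W E J e he ℓ hℓ hne
      (fun α β n h ↦ (Int.natCast_dvd_natCast.mpr hℓD).trans (hdiv α β n h))
  -- Step 2: bookkeeping in the base.
  set N : ℝ := (W.conductorNorm ℤ : ℝ) with hNdef
  set X : ℝ := (J.dim : ℝ) * max 1 W.stableFaltingsHeight with hXdef
  have hN1 : (1 : ℝ) ≤ N := by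
    have h : 1 ≤ W.conductorNorm ℤ := NeZero.one_le
    rw [hNdef]
    exact_mod_cast h
  have hN0 : (0 : ℝ) ≤ N := zero_le_one.trans hN1
  have hN2 : (1 : ℝ) ≤ N ^ 2 := one_le_pow₀ hN1
  have hmc : (1 : ℝ) ≤ max 1 c := le_max_left _ _
  have hmc0 : (0 : ℝ) ≤ max 1 c := zero_le_one.trans hmc
  have hX0 : 0 ≤ X :=
    mul_nonneg (Nat.cast_nonneg _) (zero_le_one.trans (le_max_left _ _))
  have hmax : max 1 W.stableFaltingsHeight ≤ max 1 c * N ^ 2 := by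
    refine max_le ?_ ?_
    · calc (1 : ℝ) = 1 * 1 := (mul_one 1).symm
        _ ≤ max 1 c * N ^ 2 := mul_le_mul hmc hN2 zero_le_one hmc0
    · calc W.stableFaltingsHeight ≤ c * N ^ 2 := hc W hW
        _ ≤ max 1 c * N ^ 2 :=
          mul_le_mul_of_nonneg_right (le_max_right _ _) (pow_nonneg hN0 2)
  have hXle : X ≤ max 1 c * N ^ (4 : ℕ) := by
    calc X = (J.dim : ℝ) * max 1 W.stableFaltingsHeight := rfl
      _ ≤ N ^ 2 * (max 1 c * N ^ 2) :=
          mul_le_mul hdim hmax (zero_le_one.trans (le_max_left _ _)) (pow_nonneg hN0 2)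
      _ = max 1 c * N ^ (4 : ℕ) := by ring
  have hrpow : X ^ κ ≤ (max 1 c * N ^ (4 : ℕ)) ^ κ := Real.rpow_le_rpow hX0 hXle hκ
  have h4 : N ^ (4 * κ) = (N ^ (4 : ℕ)) ^ κ := by
    rw [← Real.rpow_natCast_mul hN0]
    norm_num
  have hsplit : (max 1 c * N ^ (4 : ℕ)) ^ κ = (max 1 c) ^ κ * N ^ (4 * κ) := by
    rw [Real.mul_rpow hmc0 (pow_nonneg hN0 4), h4]
  -- Step 3: assemble.
  calc (ℓ : ℝ) ≤ C * X ^ κ := hU1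
    _ ≤ max C 0 * X ^ κ :=
        mul_le_mul_of_nonneg_right (le_max_left _ _) (Real.rpow_nonneg hX0 κ)
    _ ≤ max C 0 * ((max 1 c) ^ κ * N ^ (4 * κ)) := by
        rw [← hsplit]
        exact mul_le_mul_of_nonneg_left hrpow (le_max_right _ _)
    _ = max C 0 * (max 1 c) ^ κ * N ^ (4 * κ) := by ring

end Summit.ABC.ABC.Theorems
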